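import Summits.BirchSwinnertonDyer.BirchSwinnertonDyer.Theorems.ClassRecordThreeEulerHalvesAtThreeCartanSupplyMonomialPS
import HarnessLib

/-!
# VIRTUAL REALISATION over a cyclotomic field, IV — the cuspidal case, first summand: `Ind_{ZN}^G ψ(b/a)`

Helper file riding `--supports stmt-BirchSwinnertonDyer-19109` (crux `EulerHalvesAtThree`; UNREGISTERED sub-line `Cruxes/EulerHalvesAtThree/Lines/cartan_corr`,
seat `bsd-idea-10` g13). For `q ≡ 2 (mod 3)` the class function `χ_W` is the DIFFERENCE of two monomial characters, `Ind_{ZN}^G λ − Ind_{T_C}^G θ`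
(`ZN = {(a b; 0 a)}` = centre × unipotent radical, `λ(a b; 0 a) = ψ(b/a)` for a non-trivial additive character `ψ` of `𝔽_q`; `T_C` the non-split torus,
`θ` a cubic character). THIS FILE computes the first character: the subgroup `znSub q`, `|ZN| = q(q−1)` (`card_znSub`), the character `znChar ψ`, and
class by class (Frobenius formula of file I): scalar `q² − 1` (`znChar_scalar`), parabolic `−1` (`znChar_parabolic`, from `Σ_{b ≠ 0} ψ(b) = −1`), and `0`
on every class with `Δ ≠ 0` (`znChar_of_discr_ne_zero`: no conjugate lies in `ZN`).
HONEST FRAMING: finite-group character computation; nothing about NUM, crux 23422 ∕ 19109 or any summit statement is proved by this seat; BSD is proved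
for no curve. [folklore; cite: Bump1997 §4.1]
-/

set_option linter.dupNamespace false
set_option autoImplicit false

noncomputable section

namespace Summit.BirchSwinnertonDyer.BirchSwinnertonDyer.Theorems.CartanSupply.Monomial

open Summit.BirchSwinnertonDyer.BirchSwinnertonDyer.Theorems.CartanDegree
open Summit.BirchSwinnertonDyer.BirchSwinnertonDyer.Theorems.CartanTorusCubeCut
open scoped Classical

variable {q : ℕ} [Fact q.Prime] {k : Type*} [Field k]

/-! ## §1 The subgroup `ZN = {(a b; 0 a)}` -/

/-- `ZN`: upper-triangular invertible matrices with equal diagonal entries (centre × unipotent radical). -/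
def znSub (q : ℕ) [Fact q.Prime] : Subgroup (G q) where
  carrier := {g | (g : Mat q) 1 0 = 0 ∧ (g : Mat q) 0 0 = (g : Mat q) 1 1}
  mul_mem' := by
    rintro g h ⟨hg, hg'⟩ ⟨hh, hh'⟩
    obtain ⟨e10, e00, e11⟩ := CubicPoints.mul_entries g h
    refine ⟨by rw [e10, hg, hh, zero_mul, mul_zero, add_zero], ?_⟩
    rw [e00, e11, hg, hh, mul_zero, add_zero, zero_mul, zero_add, hg', hh']
  one_mem' := by
    simp only [Set.mem_setOf_eq, Units.val_one]
    exact ⟨Matrix.one_apply_ne (by decide), by rw [Matrix.one_apply_eq, Matrix.one_apply_eq]⟩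
  inv_mem' := by
    rintro g ⟨hg, hg'⟩
    obtain ⟨h00, h11⟩ := CubicPoints.diag_ne_zero_of_upper g hg
    obtain ⟨e10, e00, e11⟩ := CubicPoints.mul_entries g⁻¹ g
    rw [inv_mul_cancel, Units.val_one] at e10 e00 e11
    rw [Matrix.one_apply_ne (by decide), hg, mul_zero, add_zero] at e10
    have hi10 : ((g⁻¹ : G q) : Mat q) 1 0 = 0 := (mul_eq_zero.1 e10.symm).resolve_right h00
    rw [Matrix.one_apply_eq, hg, mul_zero, add_zero] at e00
    rw [Matrix.one_apply_eq, hi10, zero_mul, zero_add, ← hg'] at e11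
    refine ⟨hi10, mul_right_cancel₀ h00 ?_⟩
    rw [← e00, ← e11]

/-- PROVED: membership in `ZN`. [folklore] -/
theorem mem_znSub_iff (g : G q) : g ∈ znSub q ↔ (g : Mat q) 1 0 = 0 ∧ (g : Mat q) 0 0 = (g : Mat q) 1 1 := Iff.rfl

/-- PROVED: `(a b; 0 a) ∈ ZN`. [folklore] -/
theorem upperGL_mem_znSub (a : (ZMod q)ˣ) (b : ZMod q) : upperGL a a b ∈ znSub q :=
  ⟨(upperGL_entries a a b).2.2.1, by rw [(upperGL_entries a a b).1, (upperGL_entries a a b).2.2.2]⟩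

/-- PROVED: `ZN ≤ B`. [folklore] -/
theorem znSub_le_borelSub : znSub q ≤ borelSub q := fun _ hg => hg.1

/-- PROVED: every element of `ZN` is `(a b; 0 a)`. [folklore] -/
theorem exists_upperGL_of_mem_znSub {g : G q} (hg : g ∈ znSub q) : ∃ a : (ZMod q)ˣ, ∃ b : ZMod q, upperGL a a b = g := by
  obtain ⟨a, d, b, he⟩ := exists_upperGL_of_mem hg.1
  have had : a = d := by
    apply Units.ext
    rw [← (upperGL_entries a d b).1, ← (upperGL_entries a d b).2.2.2, he]
    exact hg.2
  exact ⟨a, b, by rw [← he, had]⟩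

/-- PROVED: `ZN` (as a finset) is the image of `(a, b) ↦ (a b; 0 a)`. [folklore] -/
theorem zn_eq_image : (Finset.univ.filter fun g : G q => (g : Mat q) 1 0 = 0 ∧ (g : Mat q) 0 0 = (g : Mat q) 1 1) =
    Finset.univ.image (fun p : (ZMod q)ˣ × ZMod q => upperGL p.1 p.1 p.2) := by
  ext g
  simp only [Finset.mem_filter, Finset.mem_univ, true_and, Finset.mem_image]
  constructor
  · intro hg
    obtain ⟨a, b, h⟩ := exists_upperGL_of_mem_znSub (g := g) hg
    exact ⟨⟨a, b⟩, h⟩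
  · rintro ⟨p, rfl⟩
    exact upperGL_mem_znSub _ _

/-- PROVED: the parametrisation of `ZN` is injective. [folklore] -/
theorem zn_param_injective : Function.Injective (fun p : (ZMod q)ˣ × ZMod q => upperGL p.1 p.1 p.2) := by
  intro p p' h
  have := upperGL_injective (q := q) (a₁ := ⟨p.1, p.1, p.2⟩) (a₂ := ⟨p'.1, p'.1, p'.2⟩) h
  simp only [Prod.mk.injEq] at this
  exact Prod.ext this.1 this.2.2

/-- PROVED: **`|ZN| = q (q − 1)`**. [folklore] -/
theorem card_znSub : Nat.card (znSub q) = q * (q - 1) := by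
  have h : (Finset.univ.filter fun g : G q => (g : Mat q) 1 0 = 0 ∧ (g : Mat q) 0 0 = (g : Mat q) 1 1).card = q * (q - 1) := by
    rw [zn_eq_image, Finset.card_image_of_injective _ zn_param_injective, Finset.card_univ, Fintype.card_prod, ZMod.card_units q,
      ZMod.card, mul_comm]
  rw [← h]
  exact Nat.subtype_card _ (fun g => by simp only [Finset.mem_filter, Finset.mem_univ, true_and]; exact Iff.rfl)

omit [Fact q.Prime] in
/-- PROVED: `|ZN| = q (q−1)` in `k`. [folklore] -/
theorem card_znSub_cast [Fact q.Prime] : (Nat.card (znSub q) : k) = (q : k) * ((q : k) - 1) := by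
  rw [card_znSub, Nat.cast_mul, Nat.cast_sub (Fact.out : q.Prime).one_lt.le, Nat.cast_one]

/-- PROVED: `|ZN| ≠ 0` in characteristic `0`. [folklore] -/
theorem card_znSub_ne_zero [CharZero k] : (Nat.card (znSub q) : k) ≠ 0 := by
  rw [card_znSub]
  have hq := (Fact.out : q.Prime)
  exact Nat.cast_ne_zero.2 (mul_ne_zero hq.ne_zero (Nat.sub_ne_zero_of_lt hq.one_lt))

/-! ## §2 The character `λ(a b; 0 a) = ψ(b/a)` -/

/-- the weight function `g ↦ ψ(g₀₁ / g₀₀)` on all of `GL₂`. -/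
def znWeight (ψ : AddChar (ZMod q) k) (g : G q) : k := ψ ((g : Mat q) 0 1 * ((g : Mat q) 0 0)⁻¹)

omit [Fact q.Prime] in
/-- PROVED: unfolding `znWeight`. [folklore] -/
theorem znWeight_apply [Fact q.Prime] (ψ : AddChar (ZMod q) k) (g : G q) : znWeight ψ g = ψ ((g : Mat q) 0 1 * ((g : Mat q) 0 0)⁻¹) := rfl

/-- PROVED: `znWeight` is multiplicative on `ZN`. [folklore] -/
theorem znWeight_mul (ψ : AddChar (ZMod q) k) {g h : G q} (hg : g ∈ znSub q) (hh : h ∈ znSub q) :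
    znWeight ψ (g * h) = znWeight ψ g * znWeight ψ h := by
  have mul_entry01 : ((g * h : G q) : Mat q) 0 1 = (g : Mat q) 0 0 * (h : Mat q) 0 1 + (g : Mat q) 0 1 * (h : Mat q) 1 1 := by
    rw [Units.val_mul, Matrix.mul_apply, Fin.sum_univ_two]
  rw [znWeight_apply, znWeight_apply, znWeight_apply, ← AddChar.map_add_eq_mul, mul_entry01, (CubicPoints.mul_entries g h).2.1, hh.1,
    mul_zero, add_zero, ← hh.2]
  have hg0 := (CubicPoints.diag_ne_zero_of_upper g hg.1).1
  have hh0 := (CubicPoints.diag_ne_zero_of_upper h hh.1).1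
  congr 1
  field_simp
  ring

/-- **The character `λ` of `ZN`** attached to an additive character `ψ` of `𝔽_q`: `(a b; 0 a) ↦ ψ(b/a)`. -/
def znChar (ψ : AddChar (ZMod q) k) : znSub q →* k where
  toFun g := znWeight ψ (g : G q)
  map_one' := by
    show znWeight ψ ((1 : znSub q) : G q) = 1
    rw [znWeight_apply, show ((1 : znSub q) : G q) = 1 from rfl, Units.val_one, Matrix.one_apply_ne (by decide), zero_mul,
      AddChar.map_zero_eq_one]
  map_mul' g h := by
    show znWeight ψ ((g * h : znSub q) : G q) = znWeight ψ (g : G q) * znWeight ψ (h : G q)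
    rw [show ((g * h : znSub q) : G q) = (g : G q) * (h : G q) from rfl, znWeight_mul ψ g.2 h.2]

/-- PROVED: unfolding `znChar`. [folklore] -/
theorem znChar_apply (ψ : AddChar (ZMod q) k) (g : znSub q) : znChar ψ g = znWeight ψ (g : G q) := rfl

/-- PROVED: **the weight of `(a b; 0 a)` is `ψ(b/a)`.** [folklore] -/
theorem wt_zn_upperGL (ψ : AddChar (ZMod q) k) (a : (ZMod q)ˣ) (b : ZMod q) :
    wt (znSub q) (znChar ψ) (upperGL a a b) = ψ (b * (a : ZMod q)⁻¹) := by
  rw [wt_of_mem _ _ (upperGL_mem_znSub a b), znChar_apply, znWeight_apply]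
  show ψ (((upperGL a a b : G q) : Mat q) 0 1 * (((upperGL a a b : G q) : Mat q) 0 0)⁻¹) = _
  rw [(upperGL_entries a a b).1, (upperGL_entries a a b).2.1]

/-- PROVED: the class sum of the weight, parametrised by `(a, b)`. [folklore] -/
theorem classSum_zn (ψ : AddChar (ZMod q) k) (P : G q → Prop) [DecidablePred P] :
    ∑ y ∈ Finset.univ.filter P, wt (znSub q) (znChar ψ) y =
      ∑ p : (ZMod q)ˣ × ZMod q, if P (upperGL p.1 p.1 p.2) then ψ (p.2 * (p.1 : ZMod q)⁻¹) else 0 := by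
  rw [Finset.sum_filter,
    ← Finset.sum_subset (Finset.subset_univ (Finset.univ.filter fun g : G q => (g : Mat q) 1 0 = 0 ∧ (g : Mat q) 0 0 = (g : Mat q) 1 1))
      (fun y _ hy => ?_)]
  · rw [zn_eq_image, Finset.sum_image (fun p _ p' _ h => zn_param_injective h)]
    refine Finset.sum_congr rfl (fun p _ => ?_)
    rw [wt_zn_upperGL]
  · have hy' : y ∉ znSub q := fun h => hy (Finset.mem_filter.2 ⟨Finset.mem_univ _, h⟩)
    rw [wt_of_not_mem _ _ hy', ite_self]

/-! ## §3 The character of `Ind_{ZN}^G λ`, class by class -/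

/-- PROVED — **SCALAR**: `χ_A(z) = q² − 1`. [folklore] -/
theorem znChar_scalar [CharZero k] (ψ : AddChar (ZMod q) k) {g : G q} (hs : IsScalarMat (g : Mat q)) :
    (monRep (znSub q) (znChar ψ)).character g = (q : k) ^ 2 - 1 := by
  have key := frobenius_GL (znSub q) (znChar ψ) g
  have hC : (Finset.univ.filter fun x : G q => x⁻¹ * g * x = g) = Finset.univ :=
    Finset.filter_true_of_mem (fun x _ => NormOne.conj_of_isScalar g x hs)
  have hcl : (Finset.univ.filter fun y : G q => ∃ x : G q, x⁻¹ * g * x = y) = {g} := by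
    ext y
    simp only [Finset.mem_filter, Finset.mem_univ, true_and, Finset.mem_singleton]
    constructor
    · rintro ⟨x, hx⟩; rw [NormOne.conj_of_isScalar g x hs] at hx; exact hx.symm
    · rintro rfl; exact ⟨1, by simp⟩
  have hgZ : g ∈ znSub q := ⟨hs.2.1, hs.2.2⟩
  have hwt : wt (znSub q) (znChar ψ) g = 1 := by
    rw [wt_of_mem _ _ hgZ, znChar_apply, znWeight_apply]
    show ψ ((g : Mat q) 0 1 * ((g : Mat q) 0 0)⁻¹) = 1
    rw [hs.1, zero_mul, AddChar.map_zero_eq_one]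
  rw [hC, hcl, Finset.sum_singleton, Finset.card_univ, hwt, mul_one, card_G_cast] at key
  apply mul_left_cancel₀ (card_znSub_ne_zero (q := q) (k := k))
  rw [key, card_znSub_cast]; ring

/-- PROVED — **`Δ ≠ 0`** (split or elliptic): `χ_A(g) = 0`, since every element of `ZN` has `Δ = 0`. [folklore] -/
theorem znChar_of_discr_ne_zero [CharZero k] (ψ : AddChar (ZMod q) k) {g : G q} (hΔ : (g : Mat q).trace ^ 2 - 4 * (g : Mat q).det ≠ 0) :
    (monRep (znSub q) (znChar ψ)).character g = 0 := by
  have key := frobenius_GL (znSub q) (znChar ψ) g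
  have hsum : ∑ y ∈ Finset.univ.filter (fun y : G q => ∃ x : G q, x⁻¹ * g * x = y), wt (znSub q) (znChar ψ) y = 0 := by
    refine Finset.sum_eq_zero (fun y hy => ?_)
    obtain ⟨x, rfl⟩ := (Finset.mem_filter.1 hy).2
    refine wt_of_not_mem _ _ (fun hZ => hΔ ?_)
    obtain ⟨a, b, he⟩ := exists_upperGL_of_mem_znSub hZ
    rw [← NormOne.discr_conj g x, ← he, (trace_det_upperGL a a b).1, (trace_det_upperGL a a b).2]
    ring
  rw [hsum, mul_zero] at key
  exact (mul_eq_zero.1 key).resolve_left card_znSub_ne_zero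

/-- PROVED: `Σ_{b ≠ 0} ψ(b · c) = −1` for a non-trivial additive character `ψ` and `c ≠ 0`. [folklore] -/
theorem sum_ne_zero_addChar {ψ : AddChar (ZMod q) k} (hψ : ψ ≠ 1) {c : ZMod q} (hc : c ≠ 0) :
    ∑ b ∈ Finset.univ.filter (fun b : ZMod q => b ≠ 0), ψ (b * c) = -1 := by
  have htot : ∑ b : ZMod q, ψ (b * c) = 0 := by
    rw [Fintype.sum_bijective (fun b : ZMod q => b * c) (mul_left_injective₀ hc).bijective_of_finite (fun b => ψ (b * c)) (fun b => ψ b)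
      (fun b => rfl)]
    exact AddChar.sum_eq_zero_of_ne_one hψ
  rw [← Finset.add_sum_erase Finset.univ _ (Finset.mem_univ (0 : ZMod q)), zero_mul, AddChar.map_zero_eq_one] at htot
  rw [Finset.filter_ne']
  linear_combination htot

/-- PROVED — **PARABOLIC**: `χ_A(g) = −1` for non-scalar `g` with `Δ = 0` (non-trivial `ψ`). [folklore] -/
theorem znChar_parabolic [CharZero k] {ψ : AddChar (ZMod q) k} (hψ : ψ ≠ 1) {g : G q} (hns : ¬ IsScalarMat (g : Mat q))
    (hΔ : (g : Mat q).trace ^ 2 - 4 * (g : Mat q).det = 0) (hq2 : q ≠ 2) :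
    (monRep (znSub q) (znChar ψ)).character g = -1 := by
  have h2 : (2 : ZMod q) ≠ 0 := (ManinLocalTwoThree.SL2ZModOddPrime.neZero_two hq2).out
  have hdet : (g : Mat q).det = ((g : Mat q).trace * 2⁻¹) * ((g : Mat q).trace * 2⁻¹) := by
    have h4 : (4 : ZMod q) ≠ 0 := by
      have : (4 : ZMod q) = 2 * 2 := by norm_num
      rw [this]; exact mul_ne_zero h2 h2
    apply mul_left_cancel₀ h4
    have e : 4 * (g : Mat q).det = (g : Mat q).trace ^ 2 := by linear_combination -hΔ
    rw [e]; field_simp; ring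
  have ha0 : (g : Mat q).trace * 2⁻¹ ≠ 0 := fun h => (Matrix.GeneralLinearGroup.det_ne_zero g) (by rw [hdet, h, mul_zero])
  have hsum2 : (g : Mat q).trace * 2⁻¹ + (g : Mat q).trace * 2⁻¹ = (g : Mat q).trace := by
    rw [← mul_two, mul_assoc, inv_mul_cancel₀ h2, mul_one]
  have key := frobenius_GL (znSub q) (znChar ψ) g
  rw [card_centralizer_parabolic hq2 g hns hΔ, classSum_zn, ← Finset.sum_filter] at key
  have hset : (Finset.univ.filter fun p : (ZMod q)ˣ × ZMod q => ∃ x : G q, x⁻¹ * g * x = upperGL p.1 p.1 p.2) =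
      (Finset.univ.filter fun b : ZMod q => b ≠ 0).image (fun b => (Units.mk0 _ ha0, b)) := by
    ext ⟨a, b⟩
    simp only [Finset.mem_filter, Finset.mem_univ, true_and, Finset.mem_image, Prod.mk.injEq]
    rw [conj_upperGL_iff g hns]
    constructor
    · rintro ⟨hnsc, hs, -⟩
      have ha : (a : ZMod q) = (g : Mat q).trace * 2⁻¹ := by
        rw [← hs, ← mul_two, mul_assoc, mul_inv_cancel₀ h2, mul_one]
      exact ⟨b, fun hb => hnsc ⟨hb, rfl⟩, Units.ext ha.symm, rfl⟩
    · rintro ⟨b', hb', ha, rfl⟩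
      have ha' : (a : ZMod q) = (g : Mat q).trace * 2⁻¹ := by rw [← ha, Units.val_mk0]
      exact ⟨fun h => hb' h.1, by rw [ha', hsum2], by rw [ha', ← hdet]⟩
  rw [hset, Finset.sum_image (fun b _ b' _ h => by simpa using h)] at key
  simp only [Units.val_mk0] at key
  rw [sum_ne_zero_addChar hψ (inv_ne_zero ha0), Nat.cast_mul, Nat.cast_sub (Fact.out : q.Prime).one_lt.le, Nat.cast_one] at key
  apply mul_left_cancel₀ (card_znSub_ne_zero (q := q) (k := k))
  rw [key, card_znSub_cast]

end Summit.BirchSwinnertonDyer.BirchSwinnertonDyer.Theorems.CartanSupply.Monomial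

end
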